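import Summits.BirchSwinnertonDyer.BirchSwinnertonDyer.Theorems.KimAtThreeDeepUpperWitnessOfZetaBodyPow
import Summits.BirchSwinnertonDyer.BirchSwinnertonDyer.Theorems.KimAtThreeDeepUpperValueRowsAnomalous
import Summits.BirchSwinnertonDyer.BirchSwinnertonDyer.Theorems.KimAtThreeDeepUpperNonAdditiveOfFineKato
import HarnessLib

/-!
# Route `KimAtThreeKolyvagin` (rung W2), crux `DeepUpperAtThreeOffKatoStratum` (item 19562): the registered stub
# `stub_nonAdditive` VERBATIM — ALL good / multiplicative rows at `3`, anomalous ones INCLUDED — by the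
# Kolyvagin-system road, from S24-DEEP ×2 + GZK + Poitou–Tate + a fine Kato package + a certificate supply

Cell `bsd-addord`, seat `bsd-addord-w2-c3` gen 6; `--supports` stmt-BirchSwinnertonDyer-19076 (parent crux; the
conclusion is child 19562's registered stub `stub_nonAdditive` token for token).  Theorems only (no definition,
no named fact, no instance, no `sorry`); nothing is asserted about any curve; cruxes stay OPEN; BSD not proved.

## What, and why

The companion `KimAtThreeDeepUpperNonAdditiveOfFineKato` (this seat, p482732) reached the non-additive
NON-ANOMALOUS rows; on a good ANOMALOUS row (`3 ∣ #Ẽ(𝔽₃) = 4 − a₃`, i.e. `a₃ ∈ {−2, 1}`) the integral twist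
of the value row has augmentation `3^α·unit`, `α = 1`, and the value row reads `s̄ = u·3^t·(3^α·δ̃_n)` (this
seat's `valueRow_of_zetaBody_pow`), whose extra `3^α` this seat's `KimAtThreeDeepUpperWitnessOfZetaBodyPow`
moves to the Kurihara side of the witnesses (`KatoKuriharaWitnessAt W k (t + α) …`) — and seat w2-acc1's END is
exponent-blind.  So ONE certificate shape serves every non-additive row: the supply (C2₃′) names an `α : ℕ`
with `v₃(∏_{q∣3A}(1 − a_q/q + 𝟙_{q∤N}/q)) = α − 1` (`α = 0` off, `α = 1` on the anomalous rows; the `q = 3`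
factor is `#Ẽ_ns(𝔽₃)/3`), and with `v₃(κK) = 1` ((C1₃)) the combined certificate is `α`.
* `deepWitnessFamily_of_zetaBody_of_valueRows_pow` — the deep-keyed family at SOME shift, witnesses at exponent
  `t + α`, value rows DISCHARGED by `valueRow_of_zetaBody_pow` (general value certificates, combined `= α`).
* `portFamilyDeep_of_fineKato₃_of_certSupply₃'` — acc1's displayed port-family shape on ALL rows
  {tower, NOT additive at `3`} ⟸ (C1₃) (as in the companion, WITHOUT the non-anomalous antecedent) + (C2₃′).
* ★ `stub_nonAdditive_of_deepFacts_of_fineKato₃_of_certSupply₃'` — **the registered stub `stub_nonAdditive` of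
  crux 19562 VERBATIM** ⟸ S24-DEEP ×2, GZK, Poitou–Tate, (C1₃), (C2₃′).  NO (DD), NO Wuthrich / Kato 14.5(3) /
  BSD₃ input, NO Manin / period / `c₃` / local-torsion hypothesis.  With seat w2-acc1's additive-defect ★
  (`stub_additiveDefect_of_deepFacts_of_fineKatoTwoExp_of_certSupply`, p475533) BOTH registered stubs of 19562 now
  stand on the same kind of displayed object — Kato's fine package at `3` + a certificate supply — and the
  planner's skeleton `DeepUpperAtThreeOffKatoStratum_of` composes them (glue file follows).
HONEST LIMITS: (C1₃) construction-shaped (exp*-shaped riders = axioms on bound witnesses; model: Kato Thm. 9.7 /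
6.6 + Bloch–Kato + Kim AJM Lemma 3.4 + Mazur's `3 ∤ c_P` at `9 ∤ N`); (C2₃′) open class-wide (per-row
decidable); nothing booked.
References: [Kato2004Asterisque] (8.1.3), Prop. 8.12, §9.4, Thm. 9.7, Thm. 6.6 (1), Ex. 13.3;
[Kim2022StructureSelmer] Lemma 3.4, §3.2.3, Thm. 3.13 and its proof, §2.2.2; [Kim2025RefinedTNC] Thm 1.1, §5;
[MazurRubin2004] Thm. 3.2.4, App. A Prop. A.2; [Sakamoto2024] Thm. 4.4; [MilneADT2006] I.4.10; acc1 memo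
W2ACC1-PORTE-19562; this seat's memo W2C3-UNIFORM-PORT-g6. -/

set_option autoImplicit false
-- the Theorems namespace of a single-conjunct summit repeats the summit name by design (D-0017)
set_option linter.dupNamespace false

noncomputable section

open scoped NumberField TensorProduct ContRepresentation Classical
open CategoryTheory Field Function Finset IsDedekindDomain NumberField WeierstrassCurve
open Rat.HeightOneSpectrum
open Literature.NumberTheory.GaloisRepresentations Literature.NumberTheory.GaloisCohomology
open Literature.NumberTheory.GaloisRepresentations.DiscreteGaloisModule
open Literature.NumberTheory.EllipticCurves Literature.NumberTheory.EllipticCurves.ModularForms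
open Literature.NumberTheory.EllipticCurves.Rank1Residual
open Literature.NumberTheory.EllipticCurves.Kato2004
open Literature.NumberTheory.EllipticCurves.Kato2004.EulerSystemValues
open Summit.BirchSwinnertonDyer.Rank1Residual.GaloisImage
open Summit.BirchSwinnertonDyer.BirchSwinnertonDyer.Theses.KimAtThreeKolyvagin
open Summit.BirchSwinnertonDyer.BirchSwinnertonDyer.Theorems.KimAtThreeDeepUpperAdditiveDefectOfPortEDeep

open Summit.BirchSwinnertonDyer.BirchSwinnertonDyer.Theorems.KimAtThreeDeepUpperWitnessOfZetaBodyPow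
open Summit.BirchSwinnertonDyer.BirchSwinnertonDyer.Theorems.KimAtThreeDeepUpperValueRowsAnomalous

namespace Summit.BirchSwinnertonDyer.BirchSwinnertonDyer.Theorems.KimAtThreeDeepUpperNonAdditiveAllOfFineKato

/-- Local notation: the TWO-EXPONENT rider clause (ii₂) at depth `j`, torsion exponent `t`, defect exponent
`e`, place `v`, for the pair `(Λ, Λf)` — seat acc6's spelling (`KimAtThreeTwoExponentWitnessPair`). -/
local notation3 (prettyPrint := false) "RIDER₂⟦" W' ", " j ", " t' ", " e' ", " v' ", " Λ' ", " Λf "⟧" =>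
  ∀ (r : Finset (HeightOneSpectrum (𝓞 ℚ)))
    (Ψ : H1 (tateRep W' 3) (cycSubgroup 3 0 r) →+
      continuousCohomology 1
        (subgroupRep (WeierstrassCurve.torsionGaloisModule W' (((3 : ℕ) : ℤ) ^ j * ((3 : ℕ) : ℤ))).toTopRep
          (cycSubgroup 3 0 r))),
    (∀ (φ : contOneCocycles (subgroupRep (tateRep W' 3).toTopRep (cycSubgroup 3 0 r)))
        (ψ : contOneCocycles
          (subgroupRep (WeierstrassCurve.torsionGaloisModule W' (((3 : ℕ) : ℤ) ^ j * ((3 : ℕ) : ℤ))).toTopRep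
            (cycSubgroup 3 0 r))),
        (∀ g, ((ψ.1 g : geomTorsion W' (((3 : ℕ) : ℤ) ^ j * ((3 : ℕ) : ℤ))) : geomPoints W') =
          TateModule.proj 3 (j + 1) (φ.1 g)) →
        Ψ (oneCocycleClass _ φ) = oneCocycleClass _ ψ) →
    ∀ (y : H1 (tateRep W' 3) (cycSubgroup 3 0 r))
      (κ₀ : galoisCohomology (WeierstrassCurve.torsionGaloisModule W' (((3 : ℕ) : ℤ) ^ j * ((3 : ℕ) : ℤ))) 1)
      (s : ℤ_[3]),
      resSubgroup (WeierstrassCurve.torsionGaloisModule W' (((3 : ℕ) : ℤ) ^ j * ((3 : ℕ) : ℤ))).toTopRep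
          (cycSubgroup 3 0 r) 1 κ₀ = Ψ y →
      galoisCohomology.localization (WeierstrassCurve.torsionGaloisModule W' (((3 : ℕ) : ℤ) ^ j * ((3 : ℕ) : ℤ)))
          (Sum.inr v') 1 κ₀ ∈ propagatedSelmerStructure W' 3 j (Sum.inr v') →
      (∃ l ∈ cycIntLattice 3 (cycLevel 3 0 r),
          (((3 : ℕ) : ℤ_[3]) ^ t') • Λ' 0 r y - ((s : ℚ_[3]) ⊗ₜ[ℚ] (1 : CyclotomicField (cycLevel 3 0 r) ℚ)) =
            (((3 : ℕ) : ℤ_[3]) ^ (j + 1)) • (l : ℚ_[3] ⊗[ℚ] CyclotomicField (cycLevel 3 0 r) ℚ)) →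
      ((3 ^ e' : ℕ) : ZMod (3 ^ (j + 1))) *
        Λf (galoisCohomology.localization
          (WeierstrassCurve.torsionGaloisModule W' (((3 : ℕ) : ℤ) ^ j * ((3 : ℕ) : ℤ))) (Sum.inr v') 1 κ₀) =
        PadicInt.toZModPow (j + 1) s

/-! ### §1 The deep-keyed witness family (exponent `t + α`) with the value rows discharged, any reduction type -/

section Row

variable (W : WeierstrassCurve ℚ) [W.IsElliptic] [W.IsGloballyMinimal]
  [ContinuousSMul ℤ_[3] (W.tateModule 3)] [Module.Free ℤ_[3] (W.tateModule 3)]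
  [Module.Finite ℤ_[3] (W.tateModule 3)]

/-- **★★ The deep-keyed witness family at SOME depth shift, value rows DISCHARGED, ANY reduction type at
`3`** — this seat's `exists_shift_deepWitnessFamily_of_zetaBody_pow` ∘ `valueRow_of_zetaBody_pow` at exponent
`t` (`hf := P.isNewformOf`), witnesses at exponent `t + α`.  Displayed: `hbody`, `hirr`, the functionals with (Λ)-clauses and (ii₂) riders,
`hcdA`, and the GENERAL value certificates `uκ`/`huκ`/`hκ0`/`huκ1`, `d′`/`hcd`/`hdd′`, `hAN`, `aM`/`haM`,
`hκa`/`hκ1` (integrality of `uκ·a₃/3`, `uκ·𝟙_{3∤N}/3`), `hE0`, the combined certificate `hκE` (`= α`), `hR0`/`hR`.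
NO reduction-type, `ht0`, bad-place, Manin or period hypothesis.
[cite: Kato2004Asterisque, (8.1.3) (p. 180), §9.4 (p. 188), Thm. 9.7 (p. 189), Thm. 6.6 (1) (p. 163) and Ex. 13.3 (pp. 224–225)]
[cite: Kim2022StructureSelmer, Thm. 3.13, Lemma 3.4 and §2.2.2] [cite: MazurRubin2004, App. A Prop. A.2 and Thm. 3.2.4] -/
theorem deepWitnessFamily_of_zetaBody_of_valueRows_pow
    {N : ℕ} [NeZero N] (P : ModularParametrizationData W N) (hN : N = W.conductorNorm ℤ)
    {ι : (n : ℕ) → (CyclotomicField n ℚ →+* ℂ)} {κK : ℝ}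
    {Λ : ∀ (k' : ℕ) (r : Finset (HeightOneSpectrum (𝓞 ℚ))),
      H1 (tateRep W 3) (cycSubgroup 3 k' r) →ₗ[ℤ_[3]] ℚ_[3] ⊗[ℚ] CyclotomicField (cycLevel 3 k' r) ℚ}
    {c d a : ℤ} {A : ℕ} [NeZero A]
    {z : ∀ (k' : ℕ) (r : (cyclotomicLevelsRat 3 (badPlaces c d A N)).Ideals),
      H1 (tateRep W 3) ((cyclotomicLevelsRat 3 (badPlaces c d A N)).level k' r.1)}
    {x : ∀ (k' : ℕ) (r : (cyclotomicLevelsRat 3 (badPlaces c d A N)).Ideals),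
      CyclotomicField (cycLevel 3 k' r.1) ℚ}
    (hbody : ZetaBody W 3 P.f ι κK Λ c d a A z x)
    (hirr : W.HasIrreducibleModPGaloisRep 3)
    {t e α : ℕ} {v₃ : HeightOneSpectrum (𝓞 ℚ)} (hv₃ : ((3 : ℕ) : 𝓞 ℚ) ∈ v₃.asIdeal)
    (Λfin : ∀ j : ℕ, galoisCohomology ((W.torsionGaloisModule (((3 : ℕ) : ℤ) ^ j * ((3 : ℕ) : ℤ))).toLocal
      (Sum.inr v₃)) 1 →+ ZMod (3 ^ (j + 1)))
    (hΛ : ∀ j : ℕ,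
      (∀ c : ZMod (3 ^ (j + 1)), ∃ x ∈ propagatedSelmerStructure W 3 j (Sum.inr v₃), Λfin j x = c) ∧
      (∀ x ∈ propagatedSelmerStructure W 3 j (Sum.inr v₃),
        Λfin j x = 0 ↔ x ∈ W.kummerSelmerStructure (((3 : ℕ) : ℤ) ^ j * ((3 : ℕ) : ℤ)) (Sum.inr v₃)))
    (hfin₂ : ∀ j : ℕ, RIDER₂⟦W, j, t, e, v₃, Λ, Λfin j⟧)
    {η : (q : HeightOneSpectrum (𝓞 ℚ)) → (ZMod (Ideal.absNorm q.asIdeal))ˣ}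
    (hcdA : ∀ q : ℕ, q.Prime → q ≡ 1 [MOD 3] → ¬ q ∣ 2 * c.natAbs * d.natAbs * A)
    -- the VALUE certificates, GENERAL shape (this seat's `valueRow_of_zetaBody_general`), level-free
    (uκ : ℚ) (huκ : (uκ : ℝ) = κK) (hκ0 : κK ≠ 0) (huκ1 : ‖(uκ : ℚ_[3])‖ ≤ 1)
    (d' : ℤ) (hcd : Int.gcd (c * d) A = 1) (hdd' : d * d' ≡ 1 [ZMOD (A : ℤ)])
    (hAN : Nat.Coprime A N)
    (aM : ℕ → ℤ) (haM : ∀ q ∈ (3 * A).primeFactors, cuspCoeff P.f q = aM q)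
    (hκa : ‖((uκ * ((aM 3 : ℚ) / (3 : ℕ)) : ℚ) : ℚ_[3])‖ ≤ 1)
    (hκ1 : ‖((uκ * (if 3 ∣ N then 0 else (1 / (3 : ℕ) : ℚ)) : ℚ) : ℚ_[3])‖ ≤ 1)
    (hE0 : ∏ q ∈ (3 * A).primeFactors, (1 - (aM q : ℚ) / q + (if q ∣ N then 0 else (1 / q : ℚ))) ≠ 0)
    (hκE : padicValRat 3
      (uκ * ∏ q ∈ (3 * A).primeFactors, (1 - (aM q : ℚ) / q + (if q ∣ N then 0 else (1 / q : ℚ)))) = α)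
    (hR0 : (c : ℚ) ^ 2 * (d : ℚ) ^ 2 * ratMinusSymbol P.f ((a : ℚ) / A) -
        (c : ℚ) * (d : ℚ) ^ 2 * ratMinusSymbol P.f ((a * c : ℚ) / A) -
        (c : ℚ) ^ 2 * (d : ℚ) * ratMinusSymbol P.f ((a * d' : ℚ) / A) +
        (c : ℚ) * (d : ℚ) * ratMinusSymbol P.f ((a * c * d' : ℚ) / A) ≠ 0)
    (hR : padicValRat 3 ((c : ℚ) ^ 2 * (d : ℚ) ^ 2 * ratMinusSymbol P.f ((a : ℚ) / A) -
        (c : ℚ) * (d : ℚ) ^ 2 * ratMinusSymbol P.f ((a * c : ℚ) / A) -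
        (c : ℚ) ^ 2 * (d : ℚ) * ratMinusSymbol P.f ((a * d' : ℚ) / A) +
        (c : ℚ) * (d : ℚ) * ratMinusSymbol P.f ((a * c * d' : ℚ) / A)) = 0) :
    ∃ N₀ : ℕ, ∀ (k : ℕ) (Dk : KolyvaginDatum (W.torsionGaloisModule (((3 : ℕ) : ℤ) ^ k * ((3 : ℕ) : ℤ)))),
      Dk.IsCanonicalTauDatumThreeAtWith W (k + N₀) k η →
      ∃ (κ : Finset (HeightOneSpectrum (𝓞 ℚ)) →
            galoisCohomology (W.torsionGaloisModule (((3 : ℕ) : ℤ) ^ k * ((3 : ℕ) : ℤ))) 1)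
        (Λ' : galoisCohomology ((W.torsionGaloisModule (((3 : ℕ) : ℤ) ^ k * ((3 : ℕ) : ℤ))).toLocal
            (Sum.inr v₃)) 1 →+ ZMod (3 ^ (k + 1)))
        (κ' : Finset (HeightOneSpectrum (𝓞 ℚ)) →
            galoisCohomology (W.torsionGaloisModule (((3 : ℕ) : ℤ) ^ k * ((3 : ℕ) : ℤ))) 1),
        KatoKuriharaWitnessAt W k (t + α) Dk v₃ P κ Λ' κ' :=
  exists_shift_deepWitnessFamily_of_zetaBody_pow W P hN hbody hirr hv₃ Λfin hΛ hfin₂ hcdA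
    fun j σ hσI hσχ r hr hKol hη => valueRow_of_zetaBody_pow hbody P.isNewformOf (by decide) hirr uκ huκ
      hκ0 huκ1 d' hcd hdd' hAN aM haM hκa hκ1 hE0 α hκE hR0 hR η j t σ hσI hσχ r hr hKol hη

end Row

/-! ### §2 ALL non-additive rows of 19562: acc1's port family from (C1₃) + (C2₃′) -/

section NonAdditive

variable
  -- (C1₃) FINE KATO PACKAGE AT A GOOD / MULTIPLICATIVE `3`, coordinate `Λ = 3·exp*_ω` (`v₃(κK) = 1`), with the
  -- rider clause (ii₂) at the row's exponents `(t, e)` — crux 19560's (C1) shape off the additive locus (every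
  -- good / multiplicative row, anomalous included)
  (hC1 : ∀ (W : WeierstrassCurve ℚ) [W.IsElliptic] [W.IsGloballyMinimal]
    [ContinuousSMul ℤ_[3] (W.tateModule 3)] [Module.Free ℤ_[3] (W.tateModule 3)]
    [Module.Finite ℤ_[3] (W.tateModule 3)],
    (∀ m : ℕ, W.HasSurjectiveModNGaloisRep (3 ^ m : ℕ)) →
    ¬ (haveI : Fact (Nat.Prime 3) := ⟨Nat.prime_three⟩; Addv W 3) →
    ∀ (v₃ : HeightOneSpectrum (𝓞 ℚ)), ((3 : ℕ) : 𝓞 ℚ) ∈ v₃.asIdeal →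
    ∀ {N : ℕ} [NeZero N] (P : ModularParametrizationData W N), N = W.conductorNorm ℤ →
      (∀ z ∈ P.L.lattice, ∃ w ∈ periodLattice P.f, z = P.c * w) →
      ∃ (t e : ℕ) (ι : (n : ℕ) → (CyclotomicField n ℚ →+* ℂ)) (κK : ℝ)
        (Λ : ∀ (k' : ℕ) (r : Finset (HeightOneSpectrum (𝓞 ℚ))),
          H1 (tateRep W 3) (cycSubgroup 3 k' r) →ₗ[ℤ_[3]] ℚ_[3] ⊗[ℚ] CyclotomicField (cycLevel 3 k' r) ℚ)
        (Λfin : ∀ j : ℕ, galoisCohomology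
          ((W.torsionGaloisModule (((3 : ℕ) : ℤ) ^ j * ((3 : ℕ) : ℤ))).toLocal (Sum.inr v₃)) 1 →+
            ZMod (3 ^ (j + 1))),
        κK ≠ 0 ∧ (∃ u : ℚ, (u : ℝ) = κK ∧ padicValRat 3 u = 1) ∧
        (∀ j : ℕ,
          (∀ c : ZMod (3 ^ (j + 1)), ∃ x ∈ propagatedSelmerStructure W 3 j (Sum.inr v₃), Λfin j x = c) ∧
          (∀ x ∈ propagatedSelmerStructure W 3 j (Sum.inr v₃),
            Λfin j x = 0 ↔ x ∈ W.kummerSelmerStructure (((3 : ℕ) : ℤ) ^ j * ((3 : ℕ) : ℤ)) (Sum.inr v₃))) ∧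
        (∀ j : ℕ, RIDER₂⟦W, j, t, e, v₃, Λ, Λfin j⟧) ∧
        ∀ (c d a : ℤ) (A : ℕ), 0 < A → Int.gcd c (6 * 3 * A) = 1 → Int.gcd d (6 * 3 * N) = 1 →
          ∃ (z : ∀ (k' : ℕ) (r : (cyclotomicLevelsRat 3 (badPlaces c d A N)).Ideals),
                H1 (tateRep W 3) ((cyclotomicLevelsRat 3 (badPlaces c d A N)).level k' r.1))
            (x : ∀ (k' : ℕ) (r : (cyclotomicLevelsRat 3 (badPlaces c d A N)).Ideals),
                CyclotomicField (cycLevel 3 k' r.1) ℚ),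
            ZetaBody W 3 P.f ι κK Λ c d a A z x)
  -- (C2₃′) CERTIFICATE SUPPLY off the additive locus: Kato's auxiliary datum with the usual guards, the cusp
  -- certificate `v₃(R⁻) = 0` and the depletion certificate `v₃(∏_{q∣3A} E_q(1)) = α − 1` for SOME `α : ℕ`
  -- (`q = 3` factor `#Ẽ_ns(𝔽₃)/3`: `α = v₃(#Ẽ_ns(𝔽₃))`, `0` off / `1` on the anomalous rows, `A`-part a unit)
  (hC2 : ∀ (W : WeierstrassCurve ℚ) [W.IsElliptic] [W.IsGloballyMinimal],
    (∀ m : ℕ, W.HasSurjectiveModNGaloisRep (3 ^ m : ℕ)) →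
    ¬ (haveI : Fact (Nat.Prime 3) := ⟨Nat.prime_three⟩; Addv W 3) →
    ∀ {N : ℕ} [NeZero N] (P : ModularParametrizationData W N), N = W.conductorNorm ℤ →
      (∀ z ∈ P.L.lattice, ∃ w ∈ periodLattice P.f, z = P.c * w) →
      ∃ (c d a : ℤ) (A : ℕ) (d' : ℤ) (aM : ℕ → ℤ) (α : ℕ),
        0 < A ∧ Int.gcd c (6 * 3 * A) = 1 ∧ Int.gcd d (6 * 3 * N) = 1 ∧
        (∀ q : ℕ, q.Prime → q ≡ 1 [MOD 3] → ¬ q ∣ 2 * c.natAbs * d.natAbs * A) ∧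
        Int.gcd (c * d) A = 1 ∧ d * d' ≡ 1 [ZMOD (A : ℤ)] ∧ Nat.Coprime A N ∧
        (∀ q ∈ (3 * A).primeFactors, cuspCoeff P.f q = aM q) ∧
        (∏ q ∈ (3 * A).primeFactors,
            (1 - (aM q : ℚ) / q + (if q ∣ N then 0 else (1 / q : ℚ))) ≠ 0) ∧
        padicValRat 3 (∏ q ∈ (3 * A).primeFactors,
            (1 - (aM q : ℚ) / q + (if q ∣ N then 0 else (1 / q : ℚ)))) = (α : ℤ) - 1 ∧
        ((c : ℚ) ^ 2 * (d : ℚ) ^ 2 * ratMinusSymbol P.f ((a : ℚ) / A) -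
            (c : ℚ) * (d : ℚ) ^ 2 * ratMinusSymbol P.f ((a * c : ℚ) / A) -
            (c : ℚ) ^ 2 * (d : ℚ) * ratMinusSymbol P.f ((a * d' : ℚ) / A) +
            (c : ℚ) * (d : ℚ) * ratMinusSymbol P.f ((a * c * d' : ℚ) / A) ≠ 0) ∧
        padicValRat 3 ((c : ℚ) ^ 2 * (d : ℚ) ^ 2 * ratMinusSymbol P.f ((a : ℚ) / A) -
            (c : ℚ) * (d : ℚ) ^ 2 * ratMinusSymbol P.f ((a * c : ℚ) / A) -
            (c : ℚ) ^ 2 * (d : ℚ) * ratMinusSymbol P.f ((a * d' : ℚ) / A) +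
            (c : ℚ) * (d : ℚ) * ratMinusSymbol P.f ((a * c * d' : ℚ) / A)) = 0)

include hC1 hC2

/-- **acc1's displayed port family on ALL non-additive rows of 19562, from (C1₃) + (C2₃′)** — per row: (C2₃′)
gives Kato's auxiliary datum, its certificates and `α`, (C1₃) gives `(t, e, ι, κK, Λ, Λfin)` and `ZetaBody` for
that datum, `v₃(κK) = 1` makes `uκ·a₃/3`, `uκ·𝟙/3` integral and — with the depletion certificate `α − 1` — the
combined certificate `α`; then §1 (shift `N₀` of the row, exponent `t + α`).  Instance binders of the
Tate module are discharged by the tree's `_holds` theorems; `E[3]` is irreducible under the tower.  Closes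
nothing; (C1₃)/(C2₃) stay displayed.
[cite: Kato2004Asterisque, (8.1.3) (p. 180), §9.4 (p. 188), Thm. 9.7 (p. 189) and Ex. 13.3 (pp. 224–225)]
[cite: Kim2022StructureSelmer, Thm. 3.13, Lemma 3.4 and §2.2.2] [cite: MazurRubin2004, App. A Prop. A.2] -/
theorem portFamilyDeep_of_fineKato₃_of_certSupply₃' :
    ∀ (W : WeierstrassCurve ℚ) [W.IsElliptic] [W.IsGloballyMinimal],
      (∀ m : ℕ, W.HasSurjectiveModNGaloisRep (3 ^ m : ℕ)) →
      ¬ (haveI : Fact (Nat.Prime 3) := ⟨Nat.prime_three⟩; Addv W 3) →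
      ∀ (v₃ : HeightOneSpectrum (𝓞 ℚ)), ((3 : ℕ) : 𝓞 ℚ) ∈ v₃.asIdeal →
      ∀ (η : (q : HeightOneSpectrum (𝓞 ℚ)) → (ZMod (Ideal.absNorm q.asIdeal))ˣ),
        (∀ q, Subgroup.zpowers (η q) = ⊤) →
      ∀ {N : ℕ} [NeZero N] (P : ModularParametrizationData W N), N = W.conductorNorm ℤ →
        (∀ z ∈ P.L.lattice, ∃ w ∈ periodLattice P.f, z = P.c * w) →
        ∃ t e : ℕ, ∀ (k : ℕ)
          (Dk : KolyvaginDatum (W.torsionGaloisModule (((3 : ℕ) : ℤ) ^ k * ((3 : ℕ) : ℤ)))),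
          Dk.IsCanonicalTauDatumThreeAtWith W (k + t) k η →
          ∃ (κ : Finset (HeightOneSpectrum (𝓞 ℚ)) →
                galoisCohomology (W.torsionGaloisModule (((3 : ℕ) : ℤ) ^ k * ((3 : ℕ) : ℤ))) 1)
            (Λ : galoisCohomology ((W.torsionGaloisModule (((3 : ℕ) : ℤ) ^ k * ((3 : ℕ) : ℤ))).toLocal
                (Sum.inr v₃)) 1 →+ ZMod (3 ^ (k + 1)))
            (κ' : Finset (HeightOneSpectrum (𝓞 ℚ)) →
                galoisCohomology (W.torsionGaloisModule (((3 : ℕ) : ℤ) ^ k * ((3 : ℕ) : ℤ))) 1),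
            KatoKuriharaWitnessAt W k e Dk v₃ P κ Λ κ' := by
  intro W _ _ htow hA v₃ hv₃ η _hη N _ P hN hlat
  haveI : Fact (Nat.Prime 3) := ⟨Nat.prime_three⟩
  haveI : ContinuousSMul ℤ_[3] (W.tateModule 3) := TateModule.continuousSMul_padicInt
  haveI : Module.Free ℤ_[3] (W.tateModule 3) := W.module_free_tateModule_holds 3
  haveI : Module.Finite ℤ_[3] (W.tateModule 3) := W.module_finite_tateModule_holds 3
  obtain ⟨c, d, a, A, d', aM, α, hApos, hcA, hdN, hcdA, hcd, hdd', hAN, haM, hE0, hE, hR0, hR⟩ :=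
    hC2 W htow hA P hN hlat
  haveI : NeZero A := ⟨hApos.ne'⟩
  obtain ⟨t, e, ι, κK, Λ, Λfin, hκ0, ⟨uκ, huκ, hvu⟩, hΛ, hfin₂, hz⟩ := hC1 W htow hA v₃ hv₃ P hN hlat
  obtain ⟨z, x, hbody⟩ := hz c d a A hApos hcA hdN
  have hirr : W.HasIrreducibleModPGaloisRep 3 :=
    KimAtThreeKolyvaginPortShared.hasIrreducibleModPGaloisRep_three_of_tower W htow
  -- `v₃(uκ) = 1`: `uκ`, `uκ·a₃/3`, `uκ·𝟙/3` are `3`-integral and the combined certificate is `0`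
  have huκ0 : uκ ≠ 0 := by rintro rfl; exact hκ0 (by rw [← huκ, Rat.cast_zero])
  have hnorm3 : ‖(uκ : ℚ_[3])‖ = 3⁻¹ := by
    rw [Padic.norm_eq_zpow_neg_valuation (by exact_mod_cast huκ0), Padic.valuation_ratCast, hvu]
    norm_num
  have huκ1 : ‖(uκ : ℚ_[3])‖ ≤ 1 := by rw [hnorm3]; norm_num
  have hthird : ∀ m : ℤ, ‖((uκ * ((m : ℚ) / (3 : ℕ)) : ℚ) : ℚ_[3])‖ ≤ 1 := by
    intro m
    rw [Rat.cast_mul, norm_mul, hnorm3, Rat.cast_div, norm_div, Rat.cast_intCast, Rat.cast_natCast,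
      Nat.cast_ofNat]
    have h3 : ‖(3 : ℚ_[3])‖ = 3⁻¹ := by
      have := Padic.norm_p (p := 3)
      simpa using this
    rw [h3]
    have hm : ‖((m : ℤ) : ℚ_[3])‖ ≤ 1 := Padic.norm_int_le_one m
    have : ‖((m : ℤ) : ℚ_[3])‖ / 3⁻¹ = 3 * ‖((m : ℤ) : ℚ_[3])‖ := by field_simp
    rw [this]
    nlinarith [norm_nonneg ((m : ℤ) : ℚ_[3])]
  have hκa : ‖((uκ * ((aM 3 : ℚ) / (3 : ℕ)) : ℚ) : ℚ_[3])‖ ≤ 1 := hthird (aM 3)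
  have hκ1 : ‖((uκ * (if 3 ∣ N then 0 else (1 / (3 : ℕ) : ℚ)) : ℚ) : ℚ_[3])‖ ≤ 1 := by
    by_cases h3N : 3 ∣ N
    · rw [if_pos h3N, mul_zero, Rat.cast_zero, norm_zero]; exact zero_le_one
    · rw [if_neg h3N]
      have h := hthird 1
      rw [Int.cast_one] at h
      exact h
  have hκE : padicValRat 3
      (uκ * ∏ q ∈ (3 * A).primeFactors, (1 - (aM q : ℚ) / q + (if q ∣ N then 0 else (1 / q : ℚ)))) = α := by
    rw [padicValRat.mul huκ0 hE0, hvu, hE]; ring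
  obtain ⟨N₀, hfam⟩ := deepWitnessFamily_of_zetaBody_of_valueRows_pow W P hN hbody hirr hv₃ Λfin hΛ
    hfin₂ hcdA uκ huκ hκ0 huκ1 d' hcd hdd' hAN aM haM hκa hκ1 hE0 hκE hR0 hR
  exact ⟨N₀, t + α, hfam⟩

/-- ★ **THE REGISTERED STUB `stub_nonAdditive` OF CRUX 19562 VERBATIM (every good / multiplicative row at `3`,
anomalous included), from S24-DEEP ×2, GZK, Poitou–Tate, (C1₃) and (C2₃′)** — acc1's reduction-free END
(`deepUpper_datum_of_poitouTate_of_port_e_deep`) fed §2's port family.  NO (DD), NO Wuthrich / BSD₃ input, NO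
`ht0`, NO bad-place certificate, NO Manin / period / `c₃` hypothesis: the non-additive rows of 19562 carry crux
19560's KIND of residual object (a fine Kato package at `3` and a certificate supply) and nothing else.  The
planner's registered composition reads `DeepUpperAtThreeOffKatoStratum_of (this hS24d hS24d₂ hGZK hPT)
(KimAtThreeDeepUpperAdditiveDefectOfFineKato.stub_additiveDefect_of_deepFacts_of_fineKatoTwoExp_of_certSupply …)`.
[cite: Kim2025RefinedTNC, Thm 1.1] [cite: Kim2022StructureSelmer, Thm. 3.13, Lemma 3.4 and §2.2.2]
[cite: Sakamoto2024, Thm. 4.4 (1)(2) (p. 926)] [cite: MilneADT2006, Ch. I, Thm. 4.10]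
[cite: Kato2004Asterisque, (8.1.3), §9.4, Thm. 9.7 and Ex. 13.3] -/
theorem stub_nonAdditive_of_deepFacts_of_fineKato₃_of_certSupply₃'
    (hS24d : S24Deep.kolyvaginSystems_freeRankOne_zmod_three_pow_deep)
    (hS24d₂ : S24Deep.kolyvaginSystems_idealOfBasis_eq_fittingIdeal_zmod_three_pow_deep)
    (hGZK : rank_eq_analyticRank_of_analyticRank_le_one)
    (hPT : poitouTate_selmerStructure_duality ℚ) :
    ∀ (W₀ : WeierstrassCurve ℚ) [W₀.IsElliptic] [W₀.IsGloballyMinimal],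
      (∀ n : ℕ, W₀.HasSurjectiveModNGaloisRep (3 ^ n : ℕ)) → Finite W₀.sha →
      ∀ {N : ℕ} [NeZero N], N = W₀.conductorNorm ℤ →
      ∀ (D₀ : Literature.NumberTheory.EllipticCurves.ModularForms.ModularParametrizationData W₀ N),
        (∀ z ∈ D₀.L.lattice, ∃ w ∈ Literature.NumberTheory.EllipticCurves.ModularForms.periodLattice D₀.f, z = D₀.c * w) →
        (∀ (W₂ : WeierstrassCurve ℚ) [W₂.IsElliptic]
          (D₂ : Literature.NumberTheory.EllipticCurves.ModularForms.ModularParametrizationData W₂ N),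
          D₂.f = D₀.f → D₀.modularDegree ≤ D₂.modularDegree) →
        (∀ r : ℚ, Literature.NumberTheory.EllipticCurves.ratPlusSymbol D₀.f r ≠ 0 →
          0 ≤ padicValRat 3 (Literature.NumberTheory.EllipticCurves.ratPlusSymbol D₀.f r)) →
        Literature.NumberTheory.EllipticCurves.kuriharaVanishingOrder W₀ 3 D₀.f = 0 →
        ¬ (haveI : Fact (Nat.Prime 3) := ⟨Nat.prime_three⟩;
            Literature.NumberTheory.EllipticCurves.Rank1Residual.Addv W₀ 3) →
        ∃ d : ℕ, Literature.NumberTheory.EllipticCurves.kuriharaPartialDeepInfty W₀ 3 D₀.f = d ∧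
          ((padicValNat 3 (Nat.card (AddCommGroup.primaryComponent W₀.sha 3)) + d : ℕ) : ℕ∞) ≤
            Literature.NumberTheory.EllipticCurves.kuriharaPartial W₀ 3 D₀.f 0 := by
  intro W₀ _ _ htow _ N _ hN D₀ hopt _ hint hord hA
  obtain ⟨v₃, η, hv₃, hη⟩ := KimAtThreeShallowEqDeepSplitGlueNoStub.exists_place_three_and_generators
  obtain ⟨t, e, hPort⟩ := portFamilyDeep_of_fineKato₃_of_certSupply₃' hC1 hC2 W₀ htow hA v₃ hv₃ η hη D₀ hN
    hopt
  exact deepUpper_datum_of_poitouTate_of_port_e_deep hS24d hS24d₂ hGZK hPT W₀ htow D₀ hint hord v₃ hv₃ η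
    hη t e hPort

end NonAdditive

end Summit.BirchSwinnertonDyer.BirchSwinnertonDyer.Theorems.KimAtThreeDeepUpperNonAdditiveAllOfFineKato

end
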